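import Literature.Analysis.FluidPDE.SelfSimilar
import Summits.NavierStokesRegularity.NavierStokesRegularity.Theorems.RungBlowupCofinal.Negative.LinearStrainParasitic
import HarnessLib

/-!
# R2 feeds the tangent flow its space-time decay — KJ-21 §4 (the v4 birth letter's form)

Negative-lane kernel (refuter lineage `ns-blowup-refuter`, g14; supports
`stmt-NavierStokesRegularity-19959`).  No route file is imported; nothing here asserts a Theses
declaration.  Companion of `RungBlowupCofinalKnssGuard` (p480997) and
`RungBlowupCofinalLinearStrainParasitic` §3 (p479890).

The v4 birth letter (`Cruxes/RungBlowupCofinal/Lines/birth.lean`, `IsForwardDSSBlowup L T C c R u p d v lam`,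
plan g21) records the tangent flow `v` as the POINTWISE limit on the open past of the Leray rescalings
`nsRescale (lam n) (u (T + ·))`, `0 < lam n → 0`, of a rung solution `u` obeying the centred KNSS rate R2
`∀ t ∈ [0,T), ∀ x, ‖u t x‖ ≤ C / (‖x‖ + √(T − t))`; its closure stub `stub_tangent_flow_closure` then asks,
among other things, for `HasTypeIDecay C v`.  That half is FREE:

* `hasTypeIDecay_of_eventually_le` — pointwise limits inherit the KNSS weight from bounds holding only
  EVENTUALLY along the sequence (the `∀ n` version is `RungBlowupCofinalLinearStrainParasitic.hasTypeIDecay_of_tendsto`);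
* `hasTypeIDecay_tangent_of_knss` — clauses 1 (`0 < T`), 6 (R2), 11 (`0 < lam n`), 12 (`lam → 0`) and 13
  (pointwise convergence) of `IsForwardDSSBlowup` imply `HasTypeIDecay C v`: at fixed `s < 0` the rescaled
  bound holds as soon as `lam n ^ 2 * (−s) < T` (`knss_rescale`).  No finite-energy, cell, DSS or rung
  hypothesis is used.
[cite: KochNadirashviliSereginSverak2009, (1.6)]
-/

open Set Filter
open scoped Topology

namespace Summit.NavierStokesRegularity.RungBlowupCofinalKnssTangentDecay

open Literature.Analysis.FluidPDE

/-- Pointwise limits inherit the KNSS weight from bounds that hold only EVENTUALLY along the sequence. -/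
theorem hasTypeIDecay_of_eventually_le
    {w : ℕ → ℝ → EuclideanSpace ℝ (Fin 3) → EuclideanSpace ℝ (Fin 3)}
    {v : ℝ → EuclideanSpace ℝ (Fin 3) → EuclideanSpace ℝ (Fin 3)} {C : ℝ}
    (hw : ∀ t < 0, ∀ x, ∀ᶠ n in atTop, ‖w n t x‖ ≤ C / (‖x‖ + Real.sqrt (-t)))
    (hlim : ∀ t < 0, ∀ x, Tendsto (fun n => w n t x) atTop (𝓝 (v t x))) :
    HasTypeIDecay C v := fun t ht x =>
  le_of_tendsto (hlim t ht x).norm (hw t ht x)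

/-- **R2 ⇒ `HasTypeIDecay C` of the tangent flow.**  If `u` obeys the centred KNSS rate with constant `C`
on `[0,T) × ℝ³` (`0 < T`), `0 < λₙ → 0`, and the Leray rescalings `nsRescale λₙ (u (T + ·))` — i.e.
`(s,y) ↦ λₙ u(T + λₙ² s, λₙ y)` — converge pointwise on the open past to `v`, then `HasTypeIDecay C v`.
(At fixed `s < 0` the rescaled bound `C/(‖y‖ + √(−s))` holds as soon as `λₙ² (−s) < T`, by
`RungBlowupCofinalLinearStrainParasitic.knss_rescale`; then `hasTypeIDecay_of_eventually_le`.) -/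
theorem hasTypeIDecay_tangent_of_knss
    {u v : ℝ → EuclideanSpace ℝ (Fin 3) → EuclideanSpace ℝ (Fin 3)} {T C : ℝ} {lam : ℕ → ℝ}
    (hT : 0 < T) (hR2 : ∀ t ∈ Ico (0 : ℝ) T, ∀ x, ‖u t x‖ ≤ C / (‖x‖ + Real.sqrt (T - t)))
    (hpos : ∀ n, 0 < lam n) (hlam : Tendsto lam atTop (𝓝 0))
    (hlim : ∀ s < 0, ∀ y,
      Tendsto (fun n => nsRescale (lam n) (fun t x => u (T + t) x) s y) atTop (𝓝 (v s y))) :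
    HasTypeIDecay C v := by
  refine hasTypeIDecay_of_eventually_le (fun s hs y => ?_) hlim
  -- eventually `λₙ² (−s) < T`, i.e. `T + λₙ² s ∈ [0, T)`
  have h2 : Tendsto (fun n => lam n ^ 2 * (-s)) atTop (𝓝 0) := by
    simpa using (hlam.pow 2).mul_const (-s)
  filter_upwards [h2.eventually (gt_mem_nhds hT)] with n hn
  have hmem : T + lam n ^ 2 * s ∈ Ico (0 : ℝ) T :=
    ⟨by linarith, by nlinarith [pow_pos (hpos n) 2]⟩
  simpa [nsRescale] using RungBlowupCofinalLinearStrainParasitic.knss_rescale (hpos n) hR2 hmem y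

end Summit.NavierStokesRegularity.RungBlowupCofinalKnssTangentDecay
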